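import Mathlib
import Summits.NavierStokesRegularity.NavierStokesRegularity.Theorems.EulerZoomLiouvillePowerGaugeEulerLiouvilleFadingTamePastTools
import HarnessLib.Audit

/-!
# Crux E `PowerGaugeEulerLiouville` (stmt-NavierStokesRegularity-19832): members with VANISHING-BORN VORTICITY are trivial
# (an ansatz-free classical past stratum: the vorticity maximum at time `s` is `o(exp(−∫_s^T ‖∇u‖_∞))` along `s → −∞`)

Route `EulerZoomLiouville` (NavierStokesRegularity), crux E.  KEY of the interim LEAD ns-typeII-p2 g10 (2026-08-28T08:28:25Z) for the width
seat ns-cas-k2 g0: «VANISHING-BORN VORTICITY».  Let `(u, p)` be a classical Euler solution on a past sub-slab `(−∞, T₁)`, `T₁ ≤ 0`, with a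
time-dependent gradient bound `‖∇u(s, y)‖ ≤ Λ(s)` (`Λ` continuous on `(−∞, T₁)`), such that for every `T < T₁`, every `ε > 0` and every `S`
there is an earlier time `s < min(S, T)` at which `exp(∫_s^T Λ) · sup_y ‖curl u(s, y)‖ ≤ ε` — "the vorticity is not born from nothing faster
than stretching allows".  Then every slice `u(T)`, `T < T₁`, is irrotational (`VorticityBirth.curl_eq_zero`), and a member of Seregin's
power-gauged class (`0 < ρ ≤ ½`) with such a past is trivial (`VorticityBirth.ae_eq_zero_of_gauge_of_vanishingBornVorticity`, via the
tree's `PastIrrotational.ae_eq_zero_of_gauge_of_pastIrrotational`; `ρ > ½` is the landed `powerGaugeEulerLiouville_largeRho`, not imported here to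
stay out of the Theses cone).

MECHANISM: the two-time Cauchy formula backwards, `ω(T, x) = ∇φ(T, s, ·)(a) ω(s, a)`, `a = φ(s, T, x)`, with the pathwise Grönwall bound
`‖∇φ(T, s, ·)(a)‖ ≤ exp ∫_s^T Λ` (`FadingPast.norm_fderiv_evolutionMap_le_exp_integral_path`): `‖ω(T, x)‖ ≤ exp(∫_s^T Λ) ‖ω(s, ·)‖_∞ ≤ ε` for
every `ε`.  Since `Λ` may grow as `s → −∞`, the LEAD's engine `FadingPast.curl_eq_fderiv_evolutionMap_apply_two_time` (stated with ONE Lipschitz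
constant for all slices) is re-derived here under compact-time Lipschitz bounds (`curl_eq_fderiv_evolutionMap_apply_two_time_local`).
It subsumes the Type-I `K < 1` branch of the lead's `IsClassicalVorticityTame` and the fading-tame `c`-branch, with no ansatz.

BINDERS: the LEAD's list verbatim except (announced on STATUS 10:0xZ) `hΛi : ∀ a b, IntervalIntegrable Λ volume a b` is replaced by
`hΛc : ContinuousOn Λ (Set.Iio T₁)` (the pathwise Grönwall needs a continuous rate), and `hρh : ρ ≤ ½` is added after `hρ` as in every other
member-level filler of the skeleton (`ρ > ½` is `powerGaugeEulerLiouville_largeRho`).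

WHAT THIS IS NOT: not NS regularity, not the crux E — a classical stratum (hypothetical Euler zoom-limit class) for the lead skeleton
`Cruxes/PowerGaugeEulerLiouville/Lines/birth.lean`, `--supports stmt-NavierStokesRegularity-19832 --as helper`.  [folklore; MajdaBertozziCUP2002
§1.6 Prop 1.8 (1.51), §2.5 (2.115)–(2.117), §4.2 (4.47)]
-/

noncomputable section

set_option linter.dupNamespace false

open MeasureTheory Set Filter Topology Metric Function
open scoped NNReal ENNReal ContDiff

namespace Summit.NavierStokesRegularity.NavierStokesRegularity.Theorems.PowerGaugeEulerLiouville.VorticityBirth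

open Literature.Analysis Literature.Analysis.FluidPDE
open Summit.NavierStokesRegularity.NavierStokesRegularity.Theorems.PowerGaugeEulerLiouville.FadingPast

variable {u : ℝ → EuclideanSpace ℝ (Fin 3) → EuclideanSpace ℝ (Fin 3)} {p : ℝ → EuclideanSpace ℝ (Fin 3) → ℝ} {T₁ : ℝ} {Λ : ℝ → ℝ}

/-! ### Compact-time Lipschitz bounds from a continuous gradient majorant -/

/-- On every pair of past times the slices have a COMMON Lipschitz constant (`Λ` is bounded on the compact interval). [folklore] -/
theorem exists_lipschitz_uIcc (hcl : IsClassicalEulerSolutionOn (Iio T₁) 0 u p) (hΛc : ContinuousOn Λ (Iio T₁))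
    (hΛ : ∀ s : ℝ, s < T₁ → ∀ y, ‖fderiv ℝ (u s) y‖ ≤ Λ s) {a b : ℝ} (ha : a < T₁) (hb : b < T₁) :
    ∃ K : ℝ≥0, ∀ s ∈ uIcc a b, LipschitzWith K (u s) := by
  have hsub : uIcc a b ⊆ Iio T₁ := (convex_Iio T₁).ordConnected.uIcc_subset ha hb
  obtain ⟨C, hC⟩ := isCompact_uIcc.exists_bound_of_continuousOn (hΛc.mono hsub)
  refine ⟨⟨max C 0, le_max_right _ _⟩, fun s hs => ?_⟩
  refine lipschitzWith_of_nnnorm_fderiv_le ((hcl.contDiff_velocity (hsub hs)).differentiable (by simp)) fun y => ?_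
  have h1 : ‖fderiv ℝ (u s) y‖ ≤ max C 0 :=
    ((hΛ s (hsub hs) y).trans ((le_abs_self _).trans ((Real.norm_eq_abs _).symm.le.trans (hC s hs)))).trans (le_max_left _ _)
  have h2 : (‖fderiv ℝ (u s) y‖₊ : ℝ) ≤ max C 0 := by rw [coe_nnnorm]; exact h1
  exact_mod_cast h2

/-- The Cauchy–Lipschitz hypotheses hold on `(−∞, T₁)` (a bound on each compact set of times suffices). [folklore] -/
theorem isUniformlyLipschitzOn (hcl : IsClassicalEulerSolutionOn (Iio T₁) 0 u p) (hΛc : ContinuousOn Λ (Iio T₁))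
    (hΛ : ∀ s : ℝ, s < T₁ → ∀ y, ‖fderiv ℝ (u s) y‖ ≤ Λ s) : ODE.IsUniformlyLipschitzOn u (Iio T₁) := by
  refine hcl.smooth_velocity.isUniformlyLipschitzOn_of_norm_fderiv_le fun C hC hCS => ?_
  obtain ⟨B, hB⟩ := hC.exists_bound_of_continuousOn (hΛc.mono hCS)
  exact ⟨B, fun t ht y => (hΛ t (hCS ht) y).trans ((le_abs_self _).trans ((Real.norm_eq_abs _).symm.le.trans (hB t ht)))⟩

/-! ### The two-time Cauchy formula under compact-time Lipschitz bounds -/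

/-- **Two-time Cauchy formula** for a classical Euler flow on `(−∞, T₁)` whose slices are Lipschitz uniformly on compact sets of times:
`ω(t, x) = ∇φ(t, t₀, ·)(a) · ω(t₀, a)`, `a = φ(t₀, t, x)` (the LEAD's `FadingPast.curl_eq_fderiv_evolutionMap_apply_two_time` with its global
Lipschitz constant relaxed to compact-time constants). [cite: MajdaBertozziCUP2002, §2.5 (2.115)–(2.117); §1.6 Prop. 1.8 (1.51)] -/
theorem curl_eq_fderiv_evolutionMap_apply_two_time_local (hcl : IsClassicalEulerSolutionOn (Iio T₁) 0 u p)
    (hΛc : ContinuousOn Λ (Iio T₁)) (hΛ : ∀ s : ℝ, s < T₁ → ∀ y, ‖fderiv ℝ (u s) y‖ ≤ Λ s)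
    {t₀ t : ℝ} (ht₀ : t₀ < T₁) (ht : t < T₁) (x : EuclideanSpace ℝ (Fin 3)) :
    curl (u t) x = fderiv ℝ (ODE.evolutionMap u t₀ t) (ODE.evolutionMap u t t₀ x)
      (curl (u t₀) (ODE.evolutionMap u t t₀ x)) := by
  -- adapted from …FadingTamePastTools (`FadingPast.curl_eq_fderiv_evolutionMap_apply_two_time`)
  set v : ℝ → EuclideanSpace ℝ (Fin 3) → EuclideanSpace ℝ (Fin 3) := fun s => u (s + t₀) with hv
  set q : ℝ → EuclideanSpace ℝ (Fin 3) → ℝ := fun s => p (s + t₀) with hq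
  set S' : Set ℝ := Iio (T₁ - t₀) with hS'
  have hclv : IsClassicalEulerSolutionOn S' 0 v q := by
    have h1 := hcl.comp_add_right t₀
    refine h1.mono (fun s hs => ?_) (uniqueDiffOn_Iio _)
    show s + t₀ < T₁
    rw [hS', mem_Iio] at hs
    linarith
  have hS'c : Convex ℝ S' := convex_Iio _
  have hU' : UniqueDiffOn ℝ S' := uniqueDiffOn_Iio _
  have h0 : (0 : ℝ) ∈ S' := by rw [hS', mem_Iio]; linarith
  have htS' : t - t₀ ∈ S' := by rw [hS', mem_Iio]; linarith
  have hLv : ODE.IsUniformlyLipschitzOn v S' := by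
    refine hclv.smooth_velocity.isUniformlyLipschitzOn_of_norm_fderiv_le fun C hC hCS => ?_
    -- `C + t₀` is a compact subset of `(−∞, T₁)`
    have hC' : IsCompact ((fun s => s + t₀) '' C) := hC.image (continuous_add_const t₀)
    have hC'S : (fun s => s + t₀) '' C ⊆ Iio T₁ := by
      rintro _ ⟨s, hs, rfl⟩
      have := hCS hs
      rw [hS', mem_Iio] at this
      show s + t₀ < T₁
      linarith
    obtain ⟨B, hB⟩ := hC'.exists_bound_of_continuousOn (hΛc.mono hC'S)
    refine ⟨B, fun s hs y => ?_⟩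
    have hs' : s + t₀ < T₁ := hC'S ⟨s, hs, rfl⟩
    exact (hΛ _ hs' y).trans ((le_abs_self _).trans ((Real.norm_eq_abs _).symm.le.trans (hB _ ⟨s, hs, rfl⟩)))
  -- the base-`0` Cauchy formula for `v` at time `t - t₀`
  have hcauchy := hclv.curl_eq_fderiv_evolutionMap_apply hS'c h0 hU' hLv htS' x
  -- the flows of `v` and `u` agree up to the time shift
  obtain ⟨K, hK⟩ := exists_lipschitz_uIcc hcl hΛc hΛ ht₀ ht
  have hfw : ODE.evolutionMap v 0 (t - t₀) = ODE.evolutionMap u t₀ t := by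
    funext y
    have h := ODE.evolutionMap_comp_add_right (v := u) (t₀ := (0 : ℝ)) (t := t - t₀) t₀ (K := K)
      (fun s hs => hK s (by simpa only [zero_add, sub_add_cancel] using hs)) y
    simpa only [zero_add, sub_add_cancel] using h
  have hbw : ODE.evolutionMap v (t - t₀) 0 = ODE.evolutionMap u t t₀ := by
    funext y
    have h := ODE.evolutionMap_comp_add_right (v := u) (t₀ := t - t₀) (t := (0 : ℝ)) t₀ (K := K)
      (fun s hs => hK s (by rw [uIcc_comm]; simpa only [zero_add, sub_add_cancel] using hs)) y
    simpa only [zero_add, sub_add_cancel] using h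
  have hvt : v (t - t₀) = u t := by simp [hv]
  have hv0 : v 0 = u t₀ := by simp [hv]
  rw [hfw, hbw, hvt, hv0] at hcauchy
  exact hcauchy

/-- **Backward Cauchy bound along one trajectory**: `‖ω(t, x)‖ ≤ exp |∫_{t₀}^t Λ| · ‖ω(t₀, φ(t₀, t, x))‖` for `t₀, t < T₁`. [folklore] -/
theorem norm_curl_le_exp_integral (hcl : IsClassicalEulerSolutionOn (Iio T₁) 0 u p)
    (hΛc : ContinuousOn Λ (Iio T₁)) (hΛ : ∀ s : ℝ, s < T₁ → ∀ y, ‖fderiv ℝ (u s) y‖ ≤ Λ s)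
    {t₀ t : ℝ} (ht₀ : t₀ < T₁) (ht : t < T₁) (x : EuclideanSpace ℝ (Fin 3)) :
    ‖curl (u t) x‖ ≤ Real.exp |∫ s in t₀..t, Λ s| * ‖curl (u t₀) (ODE.evolutionMap u t t₀ x)‖ := by
  rw [curl_eq_fderiv_evolutionMap_apply_two_time_local hcl hΛc hΛ ht₀ ht x]
  refine (ContinuousLinearMap.le_opNorm _ _).trans ?_
  gcongr
  exact norm_fderiv_evolutionMap_le_exp_integral_path (isUniformlyLipschitzOn hcl hΛc hΛ) hcl.smooth_velocity (convex_Iio _)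
    (uniqueDiffOn_Iio _) ht₀ ht _ (hΛc.mono ((convex_Iio T₁).ordConnected.uIcc_subset ht₀ ht)) fun s hs =>
      hΛ s ((convex_Iio T₁).ordConnected.uIcc_subset ht₀ ht hs) _

/-! ### Vanishing-born vorticity -/

/-- **VANISHING-BORN VORTICITY FORCES AN IRROTATIONAL PAST**: if for every `T < T₁`, `ε > 0`, `S` there is `s < min(S,T)` with
`exp(∫_s^T Λ) ‖curl u(s, y)‖ ≤ ε` for all `y`, then `curl u(T) ≡ 0` for every `T < T₁` (the backward Cauchy bound with `t₀ = s`).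
[folklore] -/
theorem curl_eq_zero (hcl : IsClassicalEulerSolutionOn (Iio T₁) 0 u p)
    (hΛc : ContinuousOn Λ (Iio T₁)) (hΛ : ∀ s : ℝ, s < T₁ → ∀ y, ‖fderiv ℝ (u s) y‖ ≤ Λ s)
    (hborn : ∀ T : ℝ, T < T₁ → ∀ ε : ℝ, 0 < ε → ∀ S : ℝ, ∃ s : ℝ, s < S ∧ s < T ∧
      ∀ y, Real.exp (∫ σ in s..T, Λ σ) * ‖curl (u s) y‖ ≤ ε)
    {T : ℝ} (hT : T < T₁) (x : EuclideanSpace ℝ (Fin 3)) : curl (u T) x = 0 := by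
  rw [← norm_le_zero_iff]
  refine le_of_forall_pos_le_add fun ε hε => ?_
  rw [zero_add]
  obtain ⟨s, -, hsT, hs⟩ := hborn T hT ε hε T
  have hsT₁ : s < T₁ := hsT.trans hT
  have hnn : 0 ≤ ∫ σ in s..T, Λ σ :=
    intervalIntegral.integral_nonneg hsT.le fun σ hσ => (norm_nonneg _).trans (hΛ σ (lt_of_le_of_lt hσ.2 hT) 0)
  calc ‖curl (u T) x‖ ≤ Real.exp |∫ σ in s..T, Λ σ| * ‖curl (u s) (ODE.evolutionMap u T s x)‖ :=
        norm_curl_le_exp_integral hcl hΛc hΛ hsT₁ hT x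
    _ = Real.exp (∫ σ in s..T, Λ σ) * ‖curl (u s) (ODE.evolutionMap u T s x)‖ := by rw [abs_of_nonneg hnn]
    _ ≤ ε := hs _

/-! ### Member level -/

/-- **MEMBERS WITH VANISHING-BORN VORTICITY ARE TRIVIAL.**  Crux hypotheses verbatim (`0 < ρ ≤ ½`, suitable weak Euler on the past slab, weak
gradient `H`, the power gauges `≤ c`) + `(u, p)` classical on `(−∞, T₁)`, `T₁ ≤ 0`, a continuous gradient majorant `Λ` on `(−∞, T₁)`, and the
vanishing-birth condition `∀ T < T₁, ∀ ε > 0, ∀ S, ∃ s < min(S,T), exp(∫_s^T Λ) sup_y ‖curl u(s,y)‖ ≤ ε` ⇒ `u = 0` a.e. on `(−∞,0) × ℝ³`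
(irrotational incompressible `C²` past + `PastIrrotational`).
[folklore; LEAD ns-typeII-p2 g10's «vanishing-born vorticity» stratum] -/
theorem ae_eq_zero_of_gauge_of_vanishingBornVorticity {ρ : ℝ} (hρ : 0 < ρ) (hρh : ρ ≤ 1 / 2)
    {H : ℝ → EuclideanSpace ℝ (Fin 3) → EuclideanSpace ℝ (Fin 3) →L[ℝ] EuclideanSpace ℝ (Fin 3)} {c₀ : ℝ≥0}
    (hsw : IsSuitableWeakSolutionOn (slab (EuclideanSpace ℝ (Fin 3)) (Iio 0) isOpen_Iio) 0 0 u p)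
    (hH : HasWeakSpatialGradientOn (slab (EuclideanSpace ℝ (Fin 3)) (Iio 0) isOpen_Iio) u H)
    (hgauge : ∀ a : ℝ, 0 < a →
      ENNReal.ofReal (a ^ (2 * ρ)) * cknA a (0 : ℝ × EuclideanSpace ℝ (Fin 3)) u +
          ENNReal.ofReal (a ^ ρ) * cknE a (0 : ℝ × EuclideanSpace ℝ (Fin 3)) H +
        ENNReal.ofReal (a ^ (2 * ρ)) * cknD a (0 : ℝ × EuclideanSpace ℝ (Fin 3)) p ≤ (c₀ : ℝ≥0∞))
    {T₁ : ℝ} (hT₁ : T₁ ≤ 0) (hcl : IsClassicalEulerSolutionOn (Set.Iio T₁) 0 u p)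
    {Λ : ℝ → ℝ} (hΛc : ContinuousOn Λ (Set.Iio T₁)) (hΛ : ∀ s : ℝ, s < T₁ → ∀ y, ‖fderiv ℝ (u s) y‖ ≤ Λ s)
    (hborn : ∀ T : ℝ, T < T₁ → ∀ ε : ℝ, 0 < ε → ∀ S : ℝ, ∃ s : ℝ, s < S ∧ s < T ∧
      ∀ y, Real.exp (∫ σ in s..T, Λ σ) * ‖curl (u s) y‖ ≤ ε) :
    uncurry u =ᵐ[volume.restrict (Iio (0 : ℝ) ×ˢ (univ : Set (EuclideanSpace ℝ (Fin 3))))] 0 :=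
  PastIrrotational.ae_eq_zero_of_gauge_of_pastIrrotational hρ hρh hsw hH hgauge hT₁
    (fun τ hτ => (hcl.contDiff_velocity hτ).of_le (by norm_cast))
    (fun τ hτ => hcl.divFree τ hτ) (fun τ hτ x => curl_eq_zero hcl hΛc hΛ hborn hτ x)

end Summit.NavierStokesRegularity.NavierStokesRegularity.Theorems.PowerGaugeEulerLiouville.VorticityBirth

end
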